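import Mathlib
import HarnessLib
import Literature.Analysis.FluidPDE.LinearizedNSTorus
import Literature.Analysis.FunctionSpaces.TorusSpaceTime

/-!
# Stub `stub_gridOfColumnar` of the line `Sketch` (crux stmt-AnomalousDissipation-10430,
# `ImpulseGrid.BoundedEnergyGrid`): the Galilean column lift

Registered signature (proved here, textually; `𝕋³ = UnitAddTorus (Fin 3)`,
`E³ = EuclideanSpace ℝ (Fin 3)` are the skeleton's local notations, redeclared below):
```
theorem stub_gridOfColumnar :
    (∃ G : 𝕋³ → E³, IsSmooth G ∧ (∀ (s : UnitAddCircle) x, G (x + Pi.single (0 : Fin 3) s) = G x) ∧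
      (∀ x, G x 0 = 0) ∧ IsDivFree G ∧ HasZeroMean G ∧ G ≠ 0 ∧
      ∃ (ν : ℕ → ℝ) (V : ℕ → 𝕋³ → E³) (p : ℕ → 𝕋³ → ℝ),
        (∀ j, 0 < ν j) ∧ Tendsto ν atTop (𝓝 0) ∧
        (∀ j, IsSteadyNSState (ν j) G (V j) (p j)) ∧
        (∀ j (s : UnitAddCircle) x, V j (x + Pi.single (0 : Fin 3) s) = V j x) ∧
        (∀ j x, V j x 0 = 0) ∧ (∀ j, HasZeroMean (V j)) ∧
        ∃ E : ℝ, ∀ j, ∫ x, ‖V j x‖ ^ 2 ≤ E) →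
    ∃ (Φ : 𝕋³ → ℝ) (G : 𝕋³ → E³) (c : ℝ), IsSmooth Φ ∧ IsSmooth G ∧
      (∀ (s : UnitAddCircle) x, Φ (x + Pi.single (1 : Fin 3) s) = Φ x ∧
        Φ (x + Pi.single (2 : Fin 3) s) = Φ x) ∧
      (∫ x, Φ x = 1) ∧ (∀ (s : UnitAddCircle) x, G (x + Pi.single (0 : Fin 3) s) = G x) ∧
      (∀ x, G x 0 = 0) ∧
      IsSmooth (fun x => Φ x • G x) ∧ IsDivFree (fun x => Φ x • G x) ∧
      HasZeroMean (fun x => Φ x • G x) ∧ (fun x => Φ x • G x) ≠ 0 ∧ 0 < c ∧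
      ∃ (ν : ℕ → ℝ) (u : ℕ → 𝕋³ → E³) (p : ℕ → 𝕋³ → ℝ),
        (∀ j, 0 < ν j) ∧ Tendsto ν atTop (𝓝 0) ∧
        (∀ j, IsSteadyNSState (ν j) (fun x => Φ x • G x) (u j) (p j)) ∧
        (∀ j, ∫ x, u j x = c • EuclideanSpace.single 0 1) ∧
        ∃ E : ℝ, ∀ j, ∫ x, ‖u j x‖ ^ 2 ≤ E
```

The GALILEAN COLUMN LIFT. From a columnar branch `(G, ν_j, V_j, p_j, E)` with invariant axis `0`
take the constant unit-mass profile `Φ := 1` (smooth; trivially `x₁`/`x₂`-invariant; `∫ 1 = 1`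
because `volume` on `T³` is a probability measure), the same `G`, the drift `c := 1`, and the
boosted states `u_j := e₀ + V_j`, `e₀ := EuclideanSpace.single 0 1`, with the same pressures and the
energy bound `1 + E`. Then `Φ • G = G` (`one_smul`); `∂ₜ u_j = 0`; the space operators ignore the
additive constant `e₀` with NO regularity hypothesis (`D(e₀ + V) = DV` identically, Mathlib
`fderiv_const_add` / `deriv_const_add`), so `Δu_j = ΔV_j`, `div u_j = div V_j` and
`(u_j·∇)u_j = DV_j[e₀] + (V_j·∇)V_j`; the cross term `DV_j(x)[e₀] = ∂₀V_j(x)` vanishes because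
`t ↦ V_j (x + [t e₀]) = V_j (x + Pi.single 0 ↑t) = V_j x` is constant (`x₀`-invariance). Hence
`u_j` is a steady state of `NS_{ν_j}(G) = NS_{ν_j}(Φ • G)`; its momentum is
`∫ u_j = e₀ + ∫ V_j = e₀ = 1 • e₀` (`HasZeroMean V_j`), and POINTWISE
`‖e₀ + V_j x‖² = 1 + 2⟪e₀, V_j x⟫ + ‖V_j x‖² = 1 + ‖V_j x‖²` since `⟪e₀, V_j x⟫ = (V_j x) 0 = 0`,
so `∫‖u_j‖² = 1 + ∫‖V_j‖² ≤ 1 + E`. Pure proof file (no definitions); the regularity-free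
constant-shift identities are adapted from
`Theorems/BaireTransferDenseLoudDesignerForcesStubGalileanCovariance.lean` (Frisch, *Turbulence*
(1995), §5.2: Galilean invariance of Navier–Stokes).
-/

-- `Summit.<Summit>.<Problem>` is the tree's mandated summit-side namespace (CONVENTIONS §2); for this
-- single-conjunct summit the two coincide, so the duplicate is deliberate.
set_option linter.dupNamespace false

noncomputable section

namespace Summit.AnomalousDissipation.AnomalousDissipation.Theorems

open MeasureTheory Filter Topology Set
open scoped InnerProductSpace ContDiff
open Literature.Analysis.FunctionSpaces Literature.Analysis.FunctionSpaces.Torus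
open Literature.Analysis.FluidPDE Literature.Analysis.FluidPDE.Torus

/-- The flat three-torus (local notation, as in the registered skeleton). -/
local notation "𝕋³" => UnitAddTorus (Fin 3)
/-- Velocity values on `T³` (local notation, as in the registered skeleton). -/
local notation "E³" => EuclideanSpace ℝ (Fin 3)

/-! ## Space operators of a constant shift `x ↦ c + g x` (no regularity needed) -/

/-- The torus Fréchet derivative ignores additive constants: `D(c + g)(x) = Dg(x)`
(Mathlib `fderiv_const_add`, no differentiability needed). [folklore] -/
theorem columnLift_fderiv_const_add {F : Type*} [NormedAddCommGroup F] [NormedSpace ℝ F] (c : F)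
    (g : 𝕋³ → F) (x : 𝕋³) : Torus.fderiv (fun z => c + g z) x = Torus.fderiv g x := by
  simp only [Torus.fderiv]
  rw [show Torus.liftAt (fun z => c + g z) x = fun v => c + Torus.liftAt g x v from rfl]
  exact fderiv_const_add c

/-- The torus Laplacian ignores additive constants: `Δ(c + g)(x) = Δg(x)` (as `D(c + g) = Dg`
identically; Mathlib `laplacian_eq_iteratedFDeriv_stdOrthonormalBasis`, `iteratedFDeriv_two_apply`).
[folklore] -/
theorem columnLift_laplacian_const_add {F : Type*} [NormedAddCommGroup F] [NormedSpace ℝ F] (c : F)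
    (g : 𝕋³ → F) (x : 𝕋³) : Torus.laplacian (fun z => c + g z) x = Torus.laplacian g x := by
  simp only [Torus.laplacian]
  rw [show Torus.liftAt (fun z => c + g z) x = fun v => c + Torus.liftAt g x v from rfl,
    InnerProductSpace.laplacian_eq_iteratedFDeriv_stdOrthonormalBasis,
    InnerProductSpace.laplacian_eq_iteratedFDeriv_stdOrthonormalBasis]
  have h : _root_.fderiv ℝ (fun v => c + Torus.liftAt g x v) = _root_.fderiv ℝ (Torus.liftAt g x) :=
    funext fun _ => fderiv_const_add c
  simp only [iteratedFDeriv_two_apply, h]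

/-- The torus divergence ignores additive constants: `div (c + g)(x) = div g (x)`
(coordinatewise Mathlib `deriv_const_add`, no differentiability needed). [folklore] -/
theorem columnLift_divergence_const_add (c : E³) (g : 𝕋³ → E³) (x : 𝕋³) :
    Torus.divergence (fun z => c + g z) x = Torus.divergence g x := by
  simp only [Torus.divergence, Torus.partialDeriv, Torus.lineDeriv, PiLp.add_apply, deriv_const_add]

/-- The convective term of a constant shift: `((c + g)·∇)(c + g)(x) = Dg(x)[c] + (g·∇)g (x)`.
[folklore] -/
theorem columnLift_convect_const_add (c : E³) (g : 𝕋³ → E³) (x : 𝕋³) :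
    Torus.convect (fun z => c + g z) (fun z => c + g z) x =
      Torus.fderiv g x c + Torus.convect g g x := by
  simp only [Torus.convect]
  rw [columnLift_fderiv_const_add, map_add]

/-- Time-independent fields have vanishing (one-sided) time derivative. [folklore] -/
theorem columnLift_timeDerivWithin_const {F : Type*} [NormedAddCommGroup F] [NormedSpace ℝ F]
    (S : Set ℝ) (w : 𝕋³ → F) (t : ℝ) (x : 𝕋³) :
    Torus.timeDerivWithin S (fun _ : ℝ => w) t x = 0 := by
  simp [Torus.timeDerivWithin]

/-! ## The drift `e₀` is inert on `x₀`-invariant fields -/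

/-- The line `t ↦ [t eᵢ]` in `T³` is the coordinate circle: `proj (t • eᵢ) = Pi.single i ↑t`.
[folklore] -/
theorem columnLift_proj_smul_single (i : Fin 3) (t : ℝ) :
    Torus.proj (t • EuclideanSpace.single i (1 : ℝ)) = Pi.single i ((t : ℝ) : UnitAddCircle) := by
  funext k
  rw [Torus.proj_smul_apply, PiLp.single_apply, Pi.single_apply]
  split_ifs <;> simp

/-- For a `C¹` field invariant along the axis `0`, `DV(x)[e₀] = ∂₀V(x) = 0`: the difference
quotients of `t ↦ V (x + [t e₀]) = V x` vanish. [folklore] -/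
theorem columnLift_fderiv_single_zero_eq_zero {F : Type*} [NormedAddCommGroup F] [NormedSpace ℝ F]
    {V : 𝕋³ → F} (hV : IsContDiff 1 V)
    (hVinv : ∀ (s : UnitAddCircle) (x : 𝕋³), V (x + Pi.single (0 : Fin 3) s) = V x) (x : 𝕋³) :
    Torus.fderiv V x (EuclideanSpace.single (0 : Fin 3) (1 : ℝ)) = 0 := by
  rw [← Torus.partialDeriv_eq_fderiv_apply hV 0 x]
  show deriv (fun t : ℝ => V (x + Torus.proj (t • EuclideanSpace.single (0 : Fin 3) (1 : ℝ)))) 0 = 0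
  have h : (fun t : ℝ => V (x + Torus.proj (t • EuclideanSpace.single (0 : Fin 3) (1 : ℝ)))) =
      fun _ => V x := by
    funext t
    rw [columnLift_proj_smul_single, hVinv]
  rw [h, deriv_const]

/-! ## The Galilean column lift of a steady state -/

/-- **Galilean column lift of a steady state.** If `V` is a smooth steady state of `NS_ν(G)` with
pressure `p`, invariant along the axis `0`, then `e₀ + V` is a steady state of `NS_ν(G)` with the
same pressure: `∂ₜ = 0`, `Δ(e₀ + V) = ΔV`, `div (e₀ + V) = div V`, and
`((e₀ + V)·∇)(e₀ + V) = DV[e₀] + (V·∇)V = (V·∇)V` by the `x₀`-invariance. [folklore] -/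
theorem columnLift_isSteadyNSState {ν : ℝ} {G V : 𝕋³ → E³} {p : 𝕋³ → ℝ}
    (hst : IsSteadyNSState ν G V p)
    (hVinv : ∀ (s : UnitAddCircle) (x : 𝕋³), V (x + Pi.single (0 : Fin 3) s) = V x) :
    IsSteadyNSState ν G (fun x => EuclideanSpace.single (0 : Fin 3) (1 : ℝ) + V x) p := by
  have hV : IsSmooth V := hst.smooth_velocity.isSmooth_slice (mem_univ 0)
  refine ⟨(isSmoothSpaceTimeOn_const (isSmooth_const _) _).add hst.smooth_velocity,
    hst.smooth_pressure, fun t _ x => ?_, fun t _ x => ?_⟩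
  · have hm := hst.momentum t (mem_univ t) x
    rw [columnLift_timeDerivWithin_const, zero_add] at hm
    rw [columnLift_timeDerivWithin_const, zero_add, columnLift_convect_const_add,
      columnLift_laplacian_const_add,
      columnLift_fderiv_single_zero_eq_zero (hV.isContDiff (by simp)) hVinv x, zero_add]
    exact hm
  · rw [columnLift_divergence_const_add]
    exact hst.divFree t (mem_univ t) x

/-! ## Momentum and energy of the lift -/

/-- **Momentum of the lift**: `∫ (e₀ + V) = e₀ = 1 • e₀` for a smooth mean-zero `V`
(the torus has volume one). [folklore] -/
theorem columnLift_integral_single_add {V : 𝕋³ → E³} (hV : IsSmooth V) (hVm : HasZeroMean V) :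
    ∫ x, (EuclideanSpace.single (0 : Fin 3) (1 : ℝ) + V x) =
      (1 : ℝ) • EuclideanSpace.single (0 : Fin 3) (1 : ℝ) := by
  have hVm' : ∫ x, V x = 0 := hVm
  rw [integral_add (integrable_const _) hV.integrable, hVm', add_zero, one_smul]
  simp

/-- **Energy of the lift**, pointwise Pythagoras: `‖e₀ + V x‖² = 1 + ‖V x‖²` when `(V x) 0 = 0`,
hence `∫‖e₀ + V‖² = 1 + ∫‖V‖²` for smooth (so square-integrable) `V`. [folklore] -/
theorem columnLift_integral_norm_sq_single_add {V : 𝕋³ → E³} (hV : IsSmooth V)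
    (hV0 : ∀ x, V x 0 = 0) :
    ∫ x, ‖EuclideanSpace.single (0 : Fin 3) (1 : ℝ) + V x‖ ^ 2 = 1 + ∫ x, ‖V x‖ ^ 2 := by
  have hpt : ∀ x, ‖EuclideanSpace.single (0 : Fin 3) (1 : ℝ) + V x‖ ^ 2 = 1 + ‖V x‖ ^ 2 :=
    fun x => by
      rw [norm_add_sq_real, EuclideanSpace.inner_single_left, hV0 x]
      simp
  have hint : Integrable (fun x => ‖V x‖ ^ 2) (volume : Measure 𝕋³) :=
    (hV.continuous.norm.pow 2).integrable_unitAddTorus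
  simp_rw [hpt]
  rw [integral_add (integrable_const _) hint]
  simp

/-! ## The registered stub -/

/-- **The registered stub `stub_gridOfColumnar`** (Galilean column lift): a columnar branch with
invariant axis `0` gives the steady grid branch with `Φ := 1`, the same `G`, `c := 1`,
`u_j := e₀ + V_j`, the same pressures and the energy bound `1 + E`
(`columnLift_isSteadyNSState`, `columnLift_integral_single_add`,
`columnLift_integral_norm_sq_single_add`; `Φ • G = G` by `one_smul`, `∫ 1 = 1` on the probability
torus). [folklore] -/
theorem stub_gridOfColumnar :
    (∃ G : 𝕋³ → E³, IsSmooth G ∧ (∀ (s : UnitAddCircle) x, G (x + Pi.single (0 : Fin 3) s) = G x) ∧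
      (∀ x, G x 0 = 0) ∧ IsDivFree G ∧ HasZeroMean G ∧ G ≠ 0 ∧
      ∃ (ν : ℕ → ℝ) (V : ℕ → 𝕋³ → E³) (p : ℕ → 𝕋³ → ℝ),
        (∀ j, 0 < ν j) ∧ Tendsto ν atTop (𝓝 0) ∧
        (∀ j, IsSteadyNSState (ν j) G (V j) (p j)) ∧
        (∀ j (s : UnitAddCircle) x, V j (x + Pi.single (0 : Fin 3) s) = V j x) ∧
        (∀ j x, V j x 0 = 0) ∧ (∀ j, HasZeroMean (V j)) ∧
        ∃ E : ℝ, ∀ j, ∫ x, ‖V j x‖ ^ 2 ≤ E) →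
    ∃ (Φ : 𝕋³ → ℝ) (G : 𝕋³ → E³) (c : ℝ), IsSmooth Φ ∧ IsSmooth G ∧
      (∀ (s : UnitAddCircle) x, Φ (x + Pi.single (1 : Fin 3) s) = Φ x ∧ Φ (x + Pi.single (2 : Fin 3) s) = Φ x) ∧
      (∫ x, Φ x = 1) ∧ (∀ (s : UnitAddCircle) x, G (x + Pi.single (0 : Fin 3) s) = G x) ∧ (∀ x, G x 0 = 0) ∧
      IsSmooth (fun x => Φ x • G x) ∧ IsDivFree (fun x => Φ x • G x) ∧
      HasZeroMean (fun x => Φ x • G x) ∧ (fun x => Φ x • G x) ≠ 0 ∧ 0 < c ∧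
      ∃ (ν : ℕ → ℝ) (u : ℕ → 𝕋³ → E³) (p : ℕ → 𝕋³ → ℝ),
        (∀ j, 0 < ν j) ∧ Tendsto ν atTop (𝓝 0) ∧
        (∀ j, IsSteadyNSState (ν j) (fun x => Φ x • G x) (u j) (p j)) ∧
        (∀ j, ∫ x, u j x = c • EuclideanSpace.single 0 1) ∧
        ∃ E : ℝ, ∀ j, ∫ x, ‖u j x‖ ^ 2 ≤ E := by
  rintro ⟨G, hG, hGinv, hG0, hGd, hGm, hGne, ν, V, p, hν, hν0, hst, hVinv, hV0, hVm, E, hE⟩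
  have hV : ∀ j, IsSmooth (V j) := fun j => (hst j).smooth_velocity.isSmooth_slice (mem_univ 0)
  have h1 : (fun x => (1 : ℝ) • G x) = G := funext fun x => one_smul ℝ (G x)
  have hs : IsSmooth (fun x => (1 : ℝ) • G x) := by rw [h1]; exact hG
  have hd : IsDivFree (fun x => (1 : ℝ) • G x) := by rw [h1]; exact hGd
  have hm : HasZeroMean (fun x => (1 : ℝ) • G x) := by rw [h1]; exact hGm
  have hne : (fun x => (1 : ℝ) • G x) ≠ 0 := by rw [h1]; exact hGne
  have hsteady : ∀ j, IsSteadyNSState (ν j) (fun x => (1 : ℝ) • G x)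
      (fun x => EuclideanSpace.single (0 : Fin 3) (1 : ℝ) + V j x) (p j) := fun j => by
    rw [h1]
    exact columnLift_isSteadyNSState (hst j) (hVinv j)
  have hmom : ∀ j, ∫ x, (EuclideanSpace.single (0 : Fin 3) (1 : ℝ) + V j x) =
      (1 : ℝ) • EuclideanSpace.single (0 : Fin 3) (1 : ℝ) :=
    fun j => columnLift_integral_single_add (hV j) (hVm j)
  have hen : ∀ j, ∫ x, ‖EuclideanSpace.single (0 : Fin 3) (1 : ℝ) + V j x‖ ^ 2 ≤ 1 + E := fun j => by
    rw [columnLift_integral_norm_sq_single_add (hV j) (hV0 j)]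
    exact add_le_add le_rfl (hE j)
  have hmass : ∫ _ : 𝕋³, (1 : ℝ) = 1 := by simp
  exact ⟨fun _ => 1, G, 1, isSmooth_const _, hG, fun _ _ => ⟨rfl, rfl⟩, hmass, hGinv, hG0, hs, hd, hm,
    hne, one_pos, ν, fun j x => EuclideanSpace.single (0 : Fin 3) (1 : ℝ) + V j x, p, hν, hν0, hsteady,
    hmom, 1 + E, hen⟩

end Summit.AnomalousDissipation.AnomalousDissipation.Theorems

end
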